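import Mathlib
import HarnessLib
import HarnessLib.Audit
import Summits.HodgeConjecture.Statement
import Summits.HodgeConjecture.HodgeConjecture.Theorems.Ring2AbelianAllWeilCellsAnchored
import Summits.HodgeConjecture.HodgeConjecture.Theorems.Ring2HypothesesWeilDiscriminantHolds
import Summits.HodgeConjecture.HodgeConjecture.Theorems.Ring2AbelianAllWeilSignCells
import Summits.HodgeConjecture.HodgeConjecture.Theorems.Ring2AbelianAllWeilCellsAnchorPointed
import HarnessLib.Audit.Status.Attr

/-!
Route: SplitImpliesAll

DORMANT since 2026-09-01T18:02:25Z (reconciler: no traction for 5 d (last activity statement-checked at 2026-08-27T17:06:25Z); parked, not closed — `ledger route dormant route-HodgeConjecture-SplitImpliesAll --off` to reactivate) — unstaffed, not closed; items shared with open routes are served there. `ledger route dormant <id> --off` reactivates.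

# Route SplitImpliesAll — Weil sixfolds = split cells in print + one variational Hodge instance per
non-split cell with its Tate anchor

X = X_split ∧ X_var ∧ X_conn ("it suffices to show", for the registered LEAF
`Theses.SevenfoldWeilCensus.WeilSixfolds` =
stmt-HodgeConjecture-2524: every rational (3,3) Weil class on every complex abelian sixfold of Weil
type (ℚ(√-d), all d > 0)
is algebraic; the deciding theorem concludes that leaf — `closes_target` = the registered RUNG leaf
«H2» of HodgeConjecture
(R5 alternative closers, D-0052/D-0061): a rung route, servable, never summit credit). Index the
Weil moduli by van Geemen's cells (ℚ(√-d), 6, δ), δ ∈ ℚˣ/Nm ℚ(√-d)ˣ.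
X_split (RESIDUAL, imported): the split cells δ = [(-1)³] have algebraic Weil classes (Markman 2025,
Thm. 1.5.1; refereed at
d = 1, 3). X_var (ATTACKED CONJUNCT): on every NON-split cell of the right sign (sign δ = -1; the
others are empty) ONE
instance of Grothendieck's variational Hodge statement holds — a flat family of Weil classes
algebraic on one fibre is
algebraic on every fibre. X_conn (crux-kind, IN PRINT, never a research target): each such cell is
isogeny-connected and carries the flat
Weil section (Landherr / van Geemen 5.2–5.5 / Deligne 1982 §4). No idea card is realised; the line
is the cell's memo row M9ᶜ
(HOME/memos/ROUTE-P3-g9.md, -g10.md) typed over ring 2's discriminant-indexed cells.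
Lean: `(∀ d : ℕ, 0 < d →
Summit.HodgeConjecture.HodgeConjecture.Ring2.Hypotheses.WeilClassesComponent 3 d
(Summit.HodgeConjecture.HodgeConjecture.Ring2.Hypotheses.splitDiscriminantClass 3 d)) ∧ (∀ d : ℕ, 0
< d → ∀ δ : Literature.AlgebraicGeometry.VanGeemen1994.weilNormResidueGroup d, δ ≠
Summit.HodgeConjecture.HodgeConjecture.Ring2.Hypotheses.splitDiscriminantClass 3 d →
Summit.HodgeConjecture.HodgeConjecture.Ring2.AbelianAll.weilSign d δ = (-1) ^ 3 →
Summit.HodgeConjecture.HodgeConjecture.Ring2.AbelianAll.IsogenyConnectedWeilComponent 3 d δ ∧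
Summit.HodgeConjecture.HodgeConjecture.Ring2.Hypotheses.WeilVariationalHodgeComponent 3 d δ)`

## Assembly
Cell decomposition (`Ring2.Hypotheses.weilSixfolds_of_components_holds`, van Geemen Lemma 5.2,
fact-free) reduces the leaf to
`∀ d > 0, ∀ δ, WeilClassesComponent 3 d δ`; the split cell is SplitSixfoldCells; a wrong-sign cell
is empty
(`Ring2.AbelianAll.weilClassesComponent_of_weilSign_ne`, proved); a right-sign non-split cell closes
by
`Ring2.AbelianAll.weilClassesComponent_of_isogenyConnected_of_variational` (CM-power anchor by Tate
in the kernel +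
NonsplitCellsConnected + NonsplitSixfoldCells). The deciding theorem `closes` (glue.lean,
kernel-checked: gate render 131 l. elaborates, standard axioms) has exactly the
three CRUX binders and proves the leaf THROUGH the Assembly item (`have hA : Assembly := …; hA hS hV
hC`), so all four
declared items are in the cone of `closes` (bc6 4/4/0) and no binder is support-kind (gate rule
glue.non-crux-hypothesis).

CLOSES_TARGET: closes rung H2 of HodgeConjecture: Summit.HodgeConjecture.HodgeConjecture.Theses.SevenfoldWeilCensus.WeilSixfolds (D-0061; not the summit Statement) — the deciding theorem of this route concludes that registered leaf instead of the Statement decl `HodgeConjecture` (class rung: servable and labelled, never counted as concluding the summit Statement).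

Rationale: WHY THIS LINE. EXACT REACH (seat P3): the tree proves, fact-free, that `WeilSixfolds` is EQUIVALENT
to the conjunction of its cells
(`Ring2.Hypotheses.weilSixfolds_iff_components`, van Geemen Lemma 5.2) and that every right-sign
cell contains a CM-power
member E₀³ × E₀³ (weights) on which the Hodge conjecture holds OUTRIGHT by Tate
(`Ring2.AbelianAll.weilComponent_cmAnchor`),
so a cell closes from isogeny-connectedness (in print) plus ONE variational-Hodge instance
(`weilClassesComponent_of_isogenyConnected_of_variational`); HC_CM is NOT consumed anywhere on this
road. Hence the entire
open content of Hodge for Weil sixfolds, beyond Markman's split theorem, is Grothendieck's VHC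
(CharlesSchnell2014Notes
Conj. 11.3.1) on countably many explicit 9-dimensional SU(3,3)-families, each through an explicit
Tate anchor — the object
the cell's germ programme (b08, Bloch1972Semiregularity / BuchweitzFlenner2003 /
BlochEsnaultKerz2014CharZero) and
hsemireg's seeds attack. Imported: Shimura-variety geometry of the Weil moduli
(Deligne1982HodgeCycles §4–5,
vanGeemen1994HodgeAV §5), Hermitian-form classification (Landherr1936HermitianForms), deformation
theory of cycles (semiregularity). What
prior routes do not do: SevenfoldWeilCensus keeps `WeilSixfolds` undivided; HeckePrymWeil's VHC item
(stmt-14497) runs along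
ℚ(√-p)-families, p ≡ 3 (4) prime ≥ 7, all dimensions, with the whole off-sector summit as
complement; hsemireg's sibling
brief «EightfoldBlochSeeds» goes UP to split eightfolds (one Bloch seed per d) and descends — this
line stays in dimension
six and pays per non-split cell, where hsemireg's NEG #1 says secant/box seeds never are
semiregular, so the two roads are
complementary, not variants.

RANKED CRUXES. #2 NonsplitSixfoldCells (crux) — for every d > 0 and every discriminant class δ ≠
[(-1)³] with sign δ = (-1)³, the variational Hodge statement holds on the Weil cell (ℚ(√-d), 6, δ):
along any smooth projective (ℚ(√-d), 6, δ)-Weil family over a smooth irreducible quasi-projective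
base, a global class with fibrewise rational (3,3) Weil restrictions that is algebraic on ONE fibre
is algebraic on EVERY fibre (ring 2's `WeilVariationalHodgeComponent 3 d δ`; memo row M9ᶜ, the
attacked conjunct). [difficulty: open-problem] (why it might fail: VHC is open beyond codim 1 /
semiregular cycles; on non-split cells no semiregular, secant or box representative is known at any
member (hsemireg VERDICT-G6: 0/218 designs at g = 6; NEG #1–#16); print reaches the split component
only (Markman2025SurveySecant Thm. 1.2) — no germ criterion applies.) [CharlesSchnell2014Notes,
Grothendieck1966deRham, Grothendieck1966, Bloch1972Semiregularity, BuchweitzFlenner2003,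
BlochEsnaultKerz2014CharZero, Markman2025SecantWeil, Markman2025SurveySecant]
#3 SplitSixfoldCells (crux) — for every d > 0 the SPLIT sixfold cell (ℚ(√-d), 6, [(-1)³]) has
algebraic Weil classes: every rational (3,3) Weil class on a polarized Weil sixfold whose
K-symmetrised hyperplane class has discriminant class [-1] is algebraic (ring 2's
`WeilClassesComponent 3 d (splitDiscriminantClass 3 d)`). RESIDUAL — the imported complement:
Markman's hyperbolic-sixfold theorem gives it for all d (tree:
`weilClassesComponent_split_three_of_markmanSixfolds'` from the UNREFEREED named fact), refereed
only at d = 3 (Schoen) and d = 1 (Koike). [difficulty: L] (why it might fail: rests on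
arXiv:2502.03415 Thm. 1.5.1, unrefereed in Aug 2026 (zbMATH: arXiv only); its semiregularity step is
«special to genus 3» (§1.5, after Thm. 1.5.1) and the d ∉ {1,3} cells have no second proof — a gap
there reopens every d ∉ {1,3}.) [Markman2025SecantWeil, Markman2025SurveySecant, Koike2004WeilHodge,
Schoen1988HodgeWeil, Schoen1998HodgeWeilAddendum, vanGeemen1994HodgeAV]
#4 NonsplitCellsConnected (crux) — for every d > 0 and every δ ≠ [(-1)³] with sign δ = (-1)³, the
cell (ℚ(√-d), 6, δ) is isogeny-connected and carries the flat Weil section: any two polarized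
members of exact discriminant class δ are joined, up to isogeny at one end, by a smooth projective
(ℚ(√-d), 6, δ)-Weil family with a global fibrewise-(3,3) class reading the given Weil class (ring
2's `IsogenyConnectedWeilComponent 3 d δ`). CRUX-KIND by the measured gate rule «every binder of
closes is a crux item» (director l.26313) — labelled IN PRINT, Literature input, not a research
target, lowest rank. In print: Landherr's classification of K-Hermitian forms by (rank, signature,
discriminant) (Landherr1936HermitianForms; vanGeemen1994HodgeAV (5.2)–(5.5)), the connected SU(3,3)
period domain with its universal family over a neat level cover (Deligne1982HodgeCycles §4, proof of
Thm. 4.8), and the flat Weil section lifted to the total space by the global invariant cycle theorem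
(DeligneHodgeII1971 (4.1.1)). [difficulty: L] (why it might fail: in print in substance (Landherr;
van Geemen 5.2–5.5; Deligne 1982 §4) but open AS TYPED: ring 2's isogeny-at-one-end clause and
`HasWeilChartsOfDisc` charts may be stronger than the printed connectedness of the SU(3,3) period
family — a misstatement, not mathematics, would break it.) [Landherr1936HermitianForms,
vanGeemen1994HodgeAV, Deligne1982HodgeCycles, DeligneHodgeII1971, Markman2025SecantWeil,
FloccariFu2026]

TWO-LAYER PLAN. Foreseen split of NonsplitSixfoldCells per cell (k = 2, glue in the tree's shape
`hc_av_of_hc_cm_of_cmAnchoredFamilies_of_localVHCAtCM`):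
GermVHCAtAnchor(3,d,δ) — the variational statement AS A GERM at ONE algebraic member of the cell
(the Tate anchor
E₀³ × E₀³ of `weilComponent_cmAnchor`, or, on the (ℚ(√-3), 6, [2])-type cells, a member of the
6-dimensional type-II
locus 𝔔(D₆) where the Weil classes are algebraic FACT-FREE,
`Ring2AbelianAll.nonsplitSixfolds_of_plusPart_pow_ne_zero`) —
and CountableUnionLocus — the algebraicity locus of a flat class is a countable union of closed
algebraic subsets of the
irreducible base (Charles–Schnell Prop. 11.3.11, proof), so an open germ is everything. First cell
to open: (ℚ(√-3), 6, δ = [-2]) (the tree's det-H convention: sign -1 = (-1)³, [-2] ≠ [-1] since 2 ∉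
Nm ℚ(√-3);
the atlas's «(ℚ(√-3), (3,3), δ = 2)» cell) — BC5 plan-only rung `WeilVariationalHodgeComponent 3 3
[-2]` (bc/NonsplitSixfoldCells_birth.lean
`stub_rung_firstCell`, elaborates; sign sanity kernel-checked). The SIX-DIMENSIONAL typed line
already in the tree is DOOR B′[d]
(`WeilTypeLadderSixfoldSlices.weilSixfolds_slice_of_floorAt_of_reachSimilar_of_similarAnchorsAwayFromSplit`):
floor at d ∧
`Literature.AlgebraicGeometry.HodgeTheory.weilFamilyReach_similar` (in print) ∧
`HasSimilarLocallyAlgebraicWeilAnchorsAwayFromSplit 3 d`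
(one germ-algebraic anchor per Weil-similarity class away from split = this line's «germ at an
anchor per non-split cell»);
TYPED AND CHECKED as the route's own LINE `similar-germ-anchors` (stubs `stub_splitFloor :
SplitSixfoldCells`, `stub_reachSimilar :
weilFamilyReach_similar` (in print), `stub_similarGermAnchors : ∀ d > 0,
HasSimilarLocallyAlgebraicWeilAnchorsAwayFromSplit 3 d` (THE
germ statement, hardest) + sorry-free `NonsplitSixfoldCells_of`; registered at birth next to the BC3
birth skeleton).
A second registered LINE on NonsplitSixfoldCells is hsemireg's up-road, by signature: stubs `∀ d, 0
< d →
Literature.AlgebraicGeometry.HodgeTheory.HasHyperbolicBlochSeed 4 d`,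
`…WeilFamilyReach.weilFamilyReach_hyperbolic`,
`…BlochSemiregularSpread (2 * 4) 4`, composed by
`WeilTypeLadderSixfoldSlices.weilSixfolds_slice_of_reach_of_blochSpread_of_hyperbolicBlochSeed_four`
+ `weilSixfolds_of_forall_slice` + `nonsplitSixfoldCells_of_weilSixfolds`
(bc/NonsplitSixfoldCells_birth.lean) — ONE item set wanted by both briefs.

KILL CRITERIA. Refutation of NonsplitSixfoldCells (one (ℚ(√-d), 6, δ)-family with a flat Weil class
algebraic on one fibre and not on
another) refutes the Hodge conjecture itself — close `refuted:NonsplitSixfoldCells` and report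
upward. A retraction of /
gap in arXiv:2502.03415 Thm. 1.5.1 does not kill the line: SplitSixfoldCells stays a crux and the d
= 1, 3 cells stay
refereed. A refutation of NonsplitCellsConnected AS TYPED (e.g. the isogeny clause or
`HasWeilChartsOfDisc` too strong)
forces a restatement (class misstated), not a pivot. MOOT if hsemireg's EightfoldBlochSeeds closes
(split eightfolds ⟹
all sixfolds, `weilSixfolds_slice_of_splitHyperplane_four`), or if SevenfoldWeilCensus's
`WeilSixfolds` is proved by any
road. MECHANICAL: opened under R5 (alternative closers, D-0052/D-0061) with `closes_target` = the
rung leaf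
`Theses.SevenfoldWeilCensus.WeilSixfolds` (label H2): class rung — servable, never summit credit;
were the leaf de-registered the
route would revert to draft (glue.conclusion-mismatch against `_root_.HodgeConjecture`) and be
re-targeted, not closed.

NOT DECOMPOSED YET. The per-cell germ split above as route ITEMS (it is a registered LINE under the
crux, not a layer of items); the
per-d finiteness of right-sign non-split classes δ (finitely many per d — not needed by `closes`);
any choice of
representative (secant sheaf, box, type-II harmonic cubic) — those are lines under the crux, not
items.

CHEAPEST FALSIFIER. Lookup, run: is any non-split sixfold cell closed in print? NO —
Markman2025SurveySecant (arXiv:2509.23403) Thm. 1.2 (sixfolds: split type only; §12 = expectations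
beyond),
Markman2025SecantWeil Thm. 1.5.1 (the det H = -1 component only), vanGeemen1994HodgeAV §7.3–7.5 (the
refereed sixfold cases:
ℚ(√-3) and ℚ(i), split class) and the tree docstring of `WeilTypeLadder.NonsplitSixfolds` («NO
sub-case is known in print for the
general member of any non-split component»). Cheapest kernel checks, RUN (bc/): the
on-path converses `S → SplitSixfoldCells`, `S → NonsplitSixfoldCells` elaborate and `S →
NonsplitCellsConnected` does NOT;
all six probes `C → S` (S = leaf and S = HodgeConjecture) FAIL; `#h21_crux_probe` 3/3 CLEAN against
the leaf; `exact?` closes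
no item; `#h21_ground` flags none — so no item is the leaf in disguise, vacuous, or already a
theorem. Cheapest mathematical attack a refuter can run this
week: hsemireg's semiregularity engine on the type-II locus 𝔔(D₆) of the (ℚ(√-3), 6, [2]) cell
(positive-dimensional,
not CM-isolated; untried in NEG #1–#16, which are secant/box designs).

NUMBERS. Cells per d: δ ranges over ℚˣ/Nm ℚ(√-d)ˣ (infinite 2-torsion group); right sign = sign δ =
(-1)³; split class = [-1]
(`Ring2.Hypotheses.splitDiscriminantClass 3 d`, van Geemen (5.4.1)); each cell is a 9-dimensional
SU(3,3)-family; the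
type-II anchor locus has dimension 6 (n(n+1)/2). Refereed split cells: d = 1 (Koike2004WeilHodge
Cor. 2.1), d = 3
(Schoen1988HodgeWeil §6 / Schoen1998HodgeWeilAddendum); all d: arXiv:2502.03415 Thm. 1.5.1
(unrefereed). hsemireg census:
g = 6: 218 design rows, 0 semiregular on non-split components.

DEFINITION REQUESTS. None. All item constants exist, and so does the layer-2 germ predicate at a
NON-CM anchor: Literature's
`Literature.AlgebraicGeometry.HodgeTheory.WeilAnchorLocalClause n d P h_P w` (variational Hodge AS A
GERM at the anchor `(P, h_P, w)`
along every `√-d`-Weil family through it; WeilClassesAnchorEngine) packaged per similarity class as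
`HasSimilarLocallyAlgebraicWeilAnchorsAwayFromSplit 3 d` (WeilFamilyReachSimilar) — the second
registered LINE on
NonsplitSixfoldCells (`Lines/similar-germ-anchors.lean`, farm rc 0, 3 stubs, composition sorry-free)
states the germ crux over them;
ring 2's CM-only `LocalVHCAtCM` is not needed on this road.

Novelty: Searches (2026-08-25): lit search --hybrid "variational Hodge conjecture abelian varieties Weil type
sixfolds discriminant" (8 docs: Deligne LNM 900, LNM 1594, Green–Griffiths–Kerr, Kerr–Pearlstein,
Voisin I/II …); lit vsearch "<the thesis in prose>" (8 docs, same books + Lange–Birkenhake,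
Kato–Usui); lit galaxy search "abelian varieties of Weil type|variational Hodge conjecture" --star
all (panama 6, pdf 2: Deligne–Milne notes, Costa–Sertöz; crabby 0); lit search "Markman secant
sheaves abelian Weil type" --source all (local 6: arXiv 2502.03415, 2509.23403, 2509.23079,
2504.13607, 2603.20268, Voisin 2025; remote: zbMATH lists 2502.03415 as arXiv-only; the survey
appeared doi:10.1137/25m1803796); lean search / grep of the 74 Theses files of the sub for
WeilVariationalHodgeComponent | IsogenyConnectedWeilComponent | splitDiscriminantClass (0 route
items).
Nearest prior art found: [corpus:paper:arxiv-2603.20268 p.5] = WeilLocusSixfolds2026, p. 5 (their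
«Theorem 7», a survey-type list of blocked methods in an UNREFEREED preprint; reliability caveat lit
§38/§101: two of its framing statements are false as written) — names «uncontrolled discriminant» as
what blocks every discriminant-specific theorem; [corpus:paper:arxiv-2509.23403 Thm. 1.2, §12] =
Markman2025SurveySecant — sixfolds of SPLIT Weil type, expectations beyond;
[corpus:paper:arxiv-2502.03415 p.3] — the component invariant (n, K, det H) and the deformation
strategy on the det H = -1 component; in the tree, ring 2 gen 8  [refs: 10.1137/25m1803796, 2502.03415, doi:10.1137/25m1803796, paper:arxiv-2603.20268, paper:arxiv-2509.23403, paper:arxiv-2502.03415, WeilLocusSixfolds2026]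

Barriers (technique_class: variational-hodge, weil-classes, hodge-locus, semiregularity): - technique_class: variational-hodge, weil-classes, hodge-locus, semiregularity
- Literature.Barriers.HodgeConjecture.CattaniDeligneKaplan1995_hodgeLocus_algebraicFor:
refutation-side no-go (no counterexample by a non-algebraic Hodge locus); on the proving side
Cattani–Deligne–Kaplan is a RESOURCE — the Weil locus is algebraic — consistent with the
countable-union step of the layer-2 plan (Charles–Schnell Prop. 11.3.11); the crux does not try to
beat it.
- Literature.Barriers.HodgeConjecture.Andre1996_hodgeClassesOnAbelianVarieties_motivated:
refutation-side no-go (Weil classes are motivated, and absolute Hodge by Deligne 1982 — file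
AbsoluteHodgeClasses.lean): it says a counterexample to NonsplitSixfoldCells would contradict
standard conjecture B for abelian varieties, i.e. the crux is believed, not that the variational
method is blocked; the route imports nothing from it.
- Literature.Barriers.HodgeConjecture.Clemens1983_griffithsGroup_infiniteRank: outside its class —
the variational instance concerns homological algebraicity of a flat rational class, not algebraic
equivalence; infinite rank of Griff does not bear.
- Literature.Barriers.HodgeConjecture.Grothendieck1969_generalHodgeConjecture_false: outside its
class — no generalized-Hodge / coniveau statement is made; only the classical (p,p) statement for
middle-dimensional Weil classes with ℚ-coefficients.
- Literature.Barriers.HodgeConjecture.AtiyahHirzebruch1962_torsionClass_notAlgebraic: outside its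
class — rational c

History (route lifecycle, newest last):
- 2026-08-25T22:28:43Z · rev 1: restated NonsplitCellsConnected (stmt-HodgeConjecture-19151) — g13 exact-reach repair, pre-emptive (no refutation on the ledger): K3 was born in ring 2's N72 form `IsogenyConnectedWeilComponent 3 d δ`, which quantifies the (operator:999:1045272)
- 2026-09-01T18:02:25Z · DORMANT — reconciler: no traction for 5 d (last activity statement-checked at 2026-08-27T17:06:25Z); parked, not closed — `ledger route dormant route-HodgeConjecture-Spli (operator:999:3010389)

sub-problem: HodgeConjecture · status: dormant · opened planner-vhodge-p3-g12-0 2026-08-25T21:13:49Z · rev 6 · ledger route-HodgeConjecture-SplitImpliesAll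
GENERATED by the gate from the ledger (D-0016/17). Provers cite these decls: `theorem foo : Summit.HodgeConjecture.HodgeConjecture.Theses.SplitImpliesAll.<Decl> := …` in Summits/HodgeConjecture/HodgeConjecture/Theorems/<Name>.lean.
-/

namespace Summit.HodgeConjecture.HodgeConjecture.Theses.SplitImpliesAll

open scoped BigOperators Topology Manifold Classical MeasureTheory ProbabilityTheory Matrix InnerProductSpace ComplexConjugate ContinuousMap
open Filter Set Function TopologicalSpace MeasureTheory

attribute [summit_statement] _root_.HodgeConjecture
attribute [summit_statement] _root_.Summit.HodgeConjecture.HodgeConjecture.Theses.SevenfoldWeilCensus.WeilSixfolds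

/-- item stmt-HodgeConjecture-19149 · crux · rank 2 · open · by planner
why it might fail: VHC is open beyond codim 1 / semiregular cycles; on non-split cells no semiregular, secant or box representative is known at any member (hsemireg VERDICT-G6: 0/218 designs at g = 6; NEG #1–#16); print reaches the split component only (Markman2025SurveySecant Thm. 1.2) — no germ criterion applies.
sources: CharlesSchnell2014Notes, Grothendieck1966deRham, Grothendieck1966, Bloch1972Semiregularity, BuchweitzFlenner2003, BlochEsnaultKerz2014CharZero
[crux] for every d > 0 and every discriminant class δ ≠ [(-1)³] with sign δ = (-1)³, the variational
Hodge statement holds on the Weil cell (ℚ(√-d), 6, δ): along any smooth projective (ℚ(√-d), 6,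
δ)-Weil family over a smooth irreducible quasi-projective base, a global class with fibrewise
rational (3,3) Weil restrictions that is algebraic on ONE fibre is algebraic on EVERY fibre (ring
2's `WeilVariationalHodgeComponent 3 d δ`; memo row M9ᶜ, the attacked conjunct). [difficulty:
open-problem] -/
@[route_item "route-HodgeConjecture-SplitImpliesAll", crux]
def NonsplitSixfoldCells : Prop :=
  ∀ d : ℕ, 0 < d → ∀ δ : Literature.AlgebraicGeometry.VanGeemen1994.weilNormResidueGroup d, δ ≠ Summit.HodgeConjecture.HodgeConjecture.Ring2.Hypotheses.splitDiscriminantClass 3 d → Summit.HodgeConjecture.HodgeConjecture.Ring2.AbelianAll.weilSign d δ = (-1) ^ 3 → Summit.HodgeConjecture.HodgeConjecture.Ring2.Hypotheses.WeilVariationalHodgeComponent 3 d δ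

/-- item stmt-HodgeConjecture-19150 · crux · rank 3 · open · by planner
why it might fail: rests on arXiv:2502.03415 Thm. 1.5.1, unrefereed in Aug 2026 (zbMATH: arXiv only); its semiregularity step is «special to genus 3» (§1.5, after Thm. 1.5.1) and the d ∉ {1,3} cells have no second proof — a gap there reopens every d ∉ {1,3}.
sources: Markman2025SecantWeil, Markman2025SurveySecant, Koike2004WeilHodge, Schoen1988HodgeWeil, Schoen1998HodgeWeilAddendum, vanGeemen1994HodgeAV
[crux] for every d > 0 the SPLIT sixfold cell (ℚ(√-d), 6, [(-1)³]) has algebraic Weil classes: every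
rational (3,3) Weil class on a polarized Weil sixfold whose K-symmetrised hyperplane class has
discriminant class [-1] is algebraic (ring 2's `WeilClassesComponent 3 d (splitDiscriminantClass 3
d)`). RESIDUAL — the imported complement: Markman's hyperbolic-sixfold theorem gives it for all d
(tree: `weilClassesComponent_split_three_of_markmanSixfolds'` from the UNREFEREED named fact),
refereed only at d = 3 (Schoen) and d = 1 (Koike). [difficulty: L] -/
@[route_item "route-HodgeConjecture-SplitImpliesAll", crux]
def SplitSixfoldCells : Prop :=
  ∀ d : ℕ, 0 < d → Summit.HodgeConjecture.HodgeConjecture.Ring2.Hypotheses.WeilClassesComponent 3 d (Summit.HodgeConjecture.HodgeConjecture.Ring2.Hypotheses.splitDiscriminantClass 3 d)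

-- earlier NonsplitCellsConnected (stmt-HodgeConjecture-19151, replaced 2026-08-25T22:28:43Z -> stmt-HodgeConjecture-19825): retired by None — ∀ d : ℕ, 0 < d → ∀ δ : Literature.AlgebraicGeometry.VanGeemen1994.weilNormResidueGroup d, δ ≠ Summit.HodgeConjecture.HodgeConjecture.Ring2.Hypotheses.splitDiscriminantClass 3 d → Summit.HodgeConjecture.HodgeConjecture.Ring2.AbelianAll.weilSign d δ = (-1) ^ 3 →
/-- item stmt-HodgeConjecture-19825 · crux · rank 4 · open · by operator
why it might fail: In print (Landherr; van Geemen 5.3–5.11; Deligne 1982 §4, pf. of 4.8) and derivable mod the named fact J1, but open AS TYPED: `HasWeilChartsOfDisc` charts, a smooth quasi-projective base and a far fibre ISOGENOUS to the E₀-tower may exceed the printed family H₃/Γ_Λ.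
sources: Landherr1936HermitianForms, vanGeemen1994HodgeAV, Deligne1982HodgeCycles, DeligneHodgeII1971, Markman2025SecantWeil
for every d > 0 and every δ ≠ [(-1)³] with sign δ = (-1)³, every polarized member of the cell
(ℚ(√-d), 6, δ) carrying a non-zero rational (3,3) Weil class is joined, up to isogeny at the far
end, to the CM TOWER E₀³(ψ₀)×E₀³(−ψ₀) of the cell by a smooth projective (ℚ(√-d), 6, δ)-Weil family
with a global fibrewise-(3,3) class reading the given class (ring 2's node of record N73
`IsogenyConnectedToCMAnchor 3 d δ`, the MINIMAL anchor-pointed form;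
`Ring2AbelianAllWeilCellsAnchorPointed`). RE-TYPED at g13 from the N72 form
`IsogenyConnectedWeilComponent 3 d δ`, whose far member is NOT required to be of Weil type (3,3) and
which is therefore refutable at n = 3 by right-sign members of K-type (5,1)/(1,5) with End⁰ a field
(sign det H = (−1)¹ = (−1)³; their isogenes carry no non-zero rational (3,3) Weil class); N72 ⟹ N73
in tree (`isogenyConnectedToCMAnchor_of_isogenyConnected`), so the restate WEAKENS a hypothesis of
`closes`. CRUX-KIND by the binder rule «every binder of closes is a crux item»; labelled IN PRINT:
Landherr's classification (vanGeemen1994HodgeAV (5.4.1)), the connected n²-dimensional family H₃/Γ_Λ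
of polarized Weil-type sixfolds, which contains the CM-tower member of clas -/
@[route_item "route-HodgeConjecture-SplitImpliesAll", crux]
def NonsplitCellsConnected : Prop :=
  ∀ d : ℕ, 0 < d → ∀ δ : Literature.AlgebraicGeometry.VanGeemen1994.weilNormResidueGroup d, δ ≠ Summit.HodgeConjecture.HodgeConjecture.Ring2.Hypotheses.splitDiscriminantClass 3 d → Summit.HodgeConjecture.HodgeConjecture.Ring2.AbelianAll.weilSign d δ = (-1) ^ 3 → Summit.HodgeConjecture.HodgeConjecture.Ring2.AbelianAll.IsogenyConnectedToCMAnchor 3 d δ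

/-- item stmt-HodgeConjecture-19152 · assembly · rank 1 · open · by planner
sources: vanGeemen1994HodgeAV, Deligne1982HodgeCycles
[assembly] SplitSixfoldCells → NonsplitSixfoldCells → NonsplitCellsConnected → WeilSixfolds (the
leaf stmt-HodgeConjecture-2524). -/
@[route_item "route-HodgeConjecture-SplitImpliesAll"]
def Assembly : Prop :=
  SplitSixfoldCells → NonsplitSixfoldCells → NonsplitCellsConnected → Summit.HodgeConjecture.HodgeConjecture.Theses.SevenfoldWeilCensus.WeilSixfolds

/-! D-0027 §2.1 — DECIDING THEOREM (planner-authored via `route open/edit --closes-file`; by operator:999:1045272 2026-08-25T22:28:43Z):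
its hypotheses are this route's items and its conclusion the registered leaf `Summit.HodgeConjecture.HodgeConjecture.Theses.SevenfoldWeilCensus.WeilSixfolds` (rung H2, D-0061) (glue_lint), and it elaborates with this file. -/

@[closes "route-HodgeConjecture-SplitImpliesAll"] theorem closes (hS : SplitSixfoldCells) (hV : NonsplitSixfoldCells) (hC : NonsplitCellsConnected) :
    Summit.HodgeConjecture.HodgeConjecture.Theses.SevenfoldWeilCensus.WeilSixfolds := by
  have hA : Assembly := fun hS' hV' hC' =>
    Summit.HodgeConjecture.HodgeConjecture.Ring2.Hypotheses.weilSixfolds_of_components_holds fun d hd δ => by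
      by_cases hδ : δ = Summit.HodgeConjecture.HodgeConjecture.Ring2.Hypotheses.splitDiscriminantClass 3 d
      · rw [hδ]; exact hS' d hd
      · by_cases hs : Summit.HodgeConjecture.HodgeConjecture.Ring2.AbelianAll.weilSign d δ = (-1) ^ 3
        · exact Summit.HodgeConjecture.HodgeConjecture.Ring2.AbelianAll.weilClassesComponent_of_isogenyConnectedToCMAnchor_of_variational
            hd (hC' d hd δ hδ hs) (hV' d hd δ hδ hs)
        · exact Summit.HodgeConjecture.HodgeConjecture.Ring2.AbelianAll.weilClassesComponent_of_weilSign_ne (by norm_num) hd hs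
  exact hA hS hV hC

end Summit.HodgeConjecture.HodgeConjecture.Theses.SplitImpliesAll
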